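import Literature.Uncategorized.ShearStressHalfDrudeAllN
import Summits.AtomisticToContinuum.HydrodynamicLimit.Theorems.ShearStressHalfDrude.Negative.WithoutOrth
import Summits.AtomisticToContinuum.HydrodynamicLimit.Theorems.BoltzmannGreenKubo.Negative.ForallN

/-!
# `ShearStressHalfDrude` is false for ALL `N`: the restriction to large `N` (i.e. collisions) is load-bearing

Negative knowledge for the crux `AntiMazurCoboundaries.ShearStressHalfDrude` (stmt-AtomisticToContinuum-14136),
from the standing disprover's `Cruxes/ShearStressHalfDrude/Disproof.lean`.
`Literature.Uncategorized.ShearStressHalfDrudeAllN` (the crux VERBATIM with `∃ N₀, ∀ N, N₀ ≤ N → …` replaced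
by `∀ N, …`; the `def` was relocated to `Literature/Uncategorized/` by the gate at accept time) is FALSE: take
`a = θ = 1`, `u₀ = 0`, `e₁ = (1,0,0) ⊥ e₂ = (0,1,0)`, `A = 1`, `φ = 1` and `N = 0` — ONE sphere of diameter
`σ < 1/2` on `𝕋³` (the flow exists by the tree's Alexander theorem `HardSphereFlow.nonempty_torus_holds` and is
free flight on its good set, `BoltzmannGreenKuboForallN.flow_vel_eq` / `window_N0`, reused from the sibling
crux's negative lemma), so the velocity is frozen, the window average of `g(w)` over `[0, τ]` is `g(w)` itself,
and the left side is the FULL static second moment `∫ g² dγ` (one-body Gibbs expectations are Gaussian,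
`ShearStressHalfDrudeNonCentred.lintegral_vel_localGibbsMeasure`, reused), while the right side is
`½ · 1 · ∫_𝕋³ 1 · ∫ g² dγ = ½ ∫ g² dγ`, and `∫ g² dγ > 0` (`g(½,½,0) = ¼`, continuity, compact support,
positive Maxwellian density).

Consequences for provers: (i) the normalisation of the crux is confirmed formally (at `N = 0` the windowed second
moment equals exactly the nominal static variance `(N+1)∫φ²∫g²dγ`, so Jensen + invariance are tight and the `½`
is real content); (ii) any proof must use the COLLISION mechanism quantitatively — no argument insensitive to
`N ≥ N₀` (equivalently, valid for the ideal/one-particle gas) can give a factor `< 1`.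
refuter-cdisprove-stmt-AtomisticToContinuum-14136-0.
-/

noncomputable section

open MeasureTheory ProbabilityTheory Filter Set Topology Real
open scoped ENNReal NNReal InnerProductSpace

namespace Summit.AtomisticToContinuum.HydrodynamicLimit.Theorems

namespace ShearStressHalfDrudeOneSphere

open Literature.MathematicalPhysics.KineticTheory Literature.Analysis.FluidPDE
open ShearStressHalfDrudeNonCentred (E1 inner_E1 lintegral_vel_localGibbsMeasure)
open BoltzmannGreenKuboForallN (flow_vel_eq window_N0)

/-- Second coordinate direction `e₂ = (0,1,0)`. -/
def E2 : V3 := EuclideanSpace.single 1 1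

/-- `e₁ ⊥ e₂`. [folklore] -/
theorem inner_E1_E2 : ⟪E1, E2⟫_ℝ = 0 := by
  simp [E1, E2, EuclideanSpace.inner_single_left]

/-- `⟪e₂, w⟫ = w₁`. [folklore] -/
theorem inner_E2 (w : V3) : ⟪E2, w⟫_ℝ = w 1 := by
  simp [E2, EuclideanSpace.inner_single_left]

/-- The crux observable at `e₁ = (1,0,0)`, `e₂ = (0,1,0)`, `A = 1`: the cutoff shear stress
`w₀ w₁ (1 - smoothTransition (‖w‖² - 1))`, written exactly as the crux instantiates it. -/
def gW : V3 → ℝ := fun w =>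
  inner ℝ E1 w * inner ℝ E2 w * (1 - Real.smoothTransition (‖w‖ ^ 2 / (1 : ℝ) ^ 2 - 1))

/-- The cutoff shear stress is continuous. [folklore] -/
theorem continuous_gW : Continuous gW := by
  unfold gW
  refine ((continuous_const.inner continuous_id).mul (continuous_const.inner continuous_id)).mul
    (continuous_const.sub (Real.smoothTransition.continuous.comp ?_))
  fun_prop

/-- The cutoff kills the observable outside the ball of radius `2`. [folklore] -/
theorem gW_eq_zero_of_two_le {w : V3} (hw : 2 ≤ ‖w‖) : gW w = 0 := by
  have h1 : (1 : ℝ) ≤ ‖w‖ ^ 2 / (1 : ℝ) ^ 2 - 1 := by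
    rw [one_pow, div_one]
    nlinarith
  unfold gW
  rw [Real.smoothTransition.one_of_one_le h1, sub_self, mul_zero]

/-- The witness velocity `w⋆ = (1/2, 1/2, 0)` where the observable equals `1/4`. -/
def wStar : V3 := EuclideanSpace.single 0 (1 / 2 : ℝ) + EuclideanSpace.single 1 (1 / 2 : ℝ)

/-- `‖w⋆‖ ≤ 1`. [folklore] -/
theorem norm_wStar_le : ‖wStar‖ ≤ 1 := by
  unfold wStar
  refine (norm_add_le _ _).trans ?_
  rw [PiLp.norm_single, PiLp.norm_single]
  norm_num

/-- `g(w⋆) = 1/4`. [folklore] -/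
theorem gW_wStar : gW wStar = 1 / 4 := by
  have h0 : ‖wStar‖ ^ 2 / (1 : ℝ) ^ 2 - 1 ≤ 0 := by
    rw [one_pow, div_one, sub_nonpos]
    have := norm_wStar_le
    nlinarith [norm_nonneg wStar]
  rw [gW, Real.smoothTransition.zero_of_nonpos h0, inner_E1, inner_E2]
  simp [wStar]
  norm_num

/-- `∫ g² dγ > 0`: the squared observable times the Maxwellian is continuous, compactly supported,
nonnegative and positive at `w⋆`. [folklore] -/
theorem integral_gW_sq_pos : 0 < ∫ v, gW v ^ 2 ∂stdGaussian V3 := by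
  rw [integral_stdGaussian_eq_integral_mul_globalMaxwellian]
  have hc : Continuous fun v : V3 => globalMaxwellian v * gW v ^ 2 :=
    continuous_globalMaxwellian.mul (continuous_gW.pow 2)
  have hs : HasCompactSupport fun v : V3 => globalMaxwellian v * gW v ^ 2 := by
    refine HasCompactSupport.intro (isCompact_closedBall (0 : V3) 2) fun w hw => ?_
    rw [Metric.mem_closedBall, dist_zero_right, not_le] at hw
    simp [gW_eq_zero_of_two_le hw.le]
  have hnn : 0 ≤ fun v : V3 => globalMaxwellian v * gW v ^ 2 := fun v =>
    mul_nonneg (globalMaxwellian_pos v).le (sq_nonneg _)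
  have hx : (fun v : V3 => globalMaxwellian v * gW v ^ 2) wStar ≠ 0 := by
    simp only [gW_wStar, ne_eq, mul_eq_zero, not_or]
    exact ⟨(globalMaxwellian_pos _).ne', by norm_num⟩
  exact hc.integral_pos_of_hasCompactSupport_nonneg_nonzero hs hnn hx

/-- **Collisions are load-bearing**: without the restriction to large `N` the crux is false —
a single free sphere (`N + 1 = 1`) never decorrelates: for `φ = 1` the window average of
`g(w)` is `g(w)` itself, so the windowed second moment equals the full static variance
`∫ g² dγ > ½ ∫ g² dγ` at every window `τ`. [folklore] -/
theorem not_shearStressHalfDrudeAllN : ¬ Literature.Uncategorized.ShearStressHalfDrudeAllN := by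
  intro h
  obtain ⟨σ₀, hσ₀, hσ⟩ := h 1 1 0 one_pos one_pos
  obtain ⟨σ, hσpos, hσlt, hσhalf, hσhalf'⟩ : ∃ σ : ℝ, 0 < σ ∧ σ < σ₀ ∧ σ ≤ 1 / 2 ∧ σ < 2⁻¹ :=
    ⟨min (σ₀ / 2) (1 / 4), lt_min (by linarith) (by norm_num),
      (min_le_left _ _).trans_lt (by linarith), (min_le_right _ _).trans (by norm_num),
      (min_le_right _ _).trans_lt (by norm_num)⟩
  obtain ⟨-, hmain⟩ := hσ σ hσpos hσlt
  have hε : hsDiameter σ 0 = σ := by simp [hsDiameter]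
  obtain ⟨Φ⟩ := HardSphereFlow.nonempty_torus_holds (d := Fin 3) (ε := hsDiameter σ 0)
    (by rw [hε]; exact hσpos) (by rw [hε]; exact hσhalf') (0 + 1)
  obtain ⟨τ, hτ, hwin⟩ := hmain E1 E2 inner_E1_E2 1 one_pos gW rfl (fun _ => 1) continuous_const
  have hle := hwin 0 Φ
  clear hwin hmain hσ h
  have hh : τ * ((0 + 1 : ℕ) : ℝ) ^ (-(1 / 3 : ℝ)) = τ := by simp
  rw [hh] at hle
  -- one sphere: the window functional is the static second moment (sibling lemma `window_N0`)
  rw [window_N0 Φ hτ (fun v => gW ((Real.sqrt 1)⁻¹ • (v - 0))), localGibbsLaw_eq] at hle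
  -- the static second moment is `∫ g² dγ`
  have hstat : ∫⁻ z, ENNReal.ofReal ((∑ i, (1 : ℝ) * gW ((Real.sqrt 1)⁻¹ • ((z i).2 - 0))) ^ 2)
      ∂localGibbsMeasure σ (fun _ => (1 : ℝ)) (fun _ => (0 : V3)) (fun _ => (1 : ℝ)) 0 =
        ∫⁻ w, ENNReal.ofReal (gW w ^ 2) ∂stdGaussian V3 := by
    have h1 : ∀ z : Config (0 + 1) (Fin 3) T3,
        (∑ i, (1 : ℝ) * gW ((Real.sqrt 1)⁻¹ • ((z i).2 - 0))) = gW ((z 0).2) := by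
      intro z
      simp
    simp_rw [h1]
    exact lintegral_vel_localGibbsMeasure hσhalf 0 0 (H := fun w => ENNReal.ofReal (gW w ^ 2))
      ((continuous_gW.pow 2).measurable.ennreal_ofReal)
  rw [hstat] at hle
  have hgW2 : Integrable (fun v => gW v ^ 2) (stdGaussian V3) := by
    have hcs : HasCompactSupport (fun v => gW v ^ 2) := by
      refine HasCompactSupport.intro (isCompact_closedBall (0 : V3) 2) fun w hw => ?_
      rw [Metric.mem_closedBall, dist_zero_right, not_le] at hw
      simp [gW_eq_zero_of_two_le hw.le]
    exact (continuous_gW.pow 2).integrable_of_hasCompactSupport hcs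
  rw [← ofReal_integral_eq_lintegral_ofReal hgW2 (ae_of_all _ fun v => sq_nonneg _)] at hle
  have hT3 : ∫ x : T3, (1 : ℝ) ^ 2 = 1 := by simp
  rw [hT3] at hle
  have hI := integral_gW_sq_pos
  have := (ENNReal.ofReal_le_ofReal_iff (by positivity)).1 hle
  norm_num at this
  linarith

end ShearStressHalfDrudeOneSphere

end Summit.AtomisticToContinuum.HydrodynamicLimit.Theorems

end
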